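import Literature.MathematicalPhysics.QuantumFieldTheory.YangMillsOS
import Literature.MathematicalPhysics.QuantumLattice.EuclideanAction
import HarnessLib

/-!
# `ContinuumFromLatticeGap` (stmt-QuantumFields-15915), line `registered` (reshape 7): `stub_lawToCofinal`

Support file for the crux item stmt-QuantumFields-15915
(`Summit.QuantumFields.YangMills.Theses.GronwallGap.ContinuumFromLatticeGap`), registered stub
`stub_lawToCofinal` of the line `registered` (reshape 7): **the pointwise one-scale law implies ONE SCALE at the
lock with cofinal volumes**.

Reshape 7 replaces the datum-relative open stub `stub_oneScaleCofinal` (reshape 6: for every locked critical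
datum `(β_k → ∞, m̂_k, S₁, K)` with UNIFORM ∧ SHARP ∧ `m̂ → 0`, a unit `a_k` pinned by `Δ₀ a_k ≤ m̂(φ k)`, cofinal
polynomial volumes, ONE past-supported bump and the floor ∧ window of the bare truncated curvature two-point
function, eventually) by the POINTWISE law `stub_oneScaleLaw`: for every `K > 0` there are ONE bump `u`, `p`,
`M`, `Δ₀`, `β₀`, `m₀` such that at every single coupling `β ≥ β₀` and every rate `0 < m ≤ m₀` that clusters every
pair of local gauge-invariant species on all odd tori beyond some threshold (UNIF₁) and is `K`-sharp (SHARP₁),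
some unit `a` with `Δ₀ a ≤ m` carries the floor `a ^ p ≤ T⁰(u)` and the window `T⁰(u) ≤ M T⁰(τ₋₁ u)` on a cofinal
set of tori — no sequences, no subsequences, no schemes.  This file proves that the law implies the reshape-6
stub verbatim: along a datum take `φ = id`, the law's unit at the (eventually admissible) indices and
`m̂_k / Δ₀` elsewhere, volumes above `max (L₀ k) (S₁ k) ⌈a_k⁻²⌉₊` from the law's cofinal set (polynomial growth
with `N = 1`), and identify the stub's `T u k` — `latticeSchwinger` of the bare scheme at `n = 2, 1` — with the
law's explicit integrals (`Fin.prod_univ_two`, `Fin.prod_univ_one`).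

No definitions, no facts. [folklore]
-/

noncomputable section

namespace Summit.QuantumFields.YangMills.Theorems.ContinuumFromLatticeGap

open scoped SchwartzMap
open Filter Topology MeasureTheory
open Literature.MathematicalPhysics.QuantumFieldTheory Literature.MathematicalPhysics.QuantumLattice
  Literature.Probability.LatticeModels

/-- The bare two-point / one-point bookkeeping: for the bare scheme record built on `(a, b, L)` the
truncated curvature two-point function of the statement (`latticeSchwinger` at `n = 2` minus the product
of the two `n = 1` functions) is the explicit covariance of the two smeared action densities. [folklore] -/
theorem bare_truncatedTwoPoint_eq {G : Type} [Group G] [TopologicalSpace G] [IsTopologicalGroup G]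
    [CompactSpace G] [MeasurableSpace G] [BorelSpace G] (r : LatticeRep G) (a : ℕ → ℝ)
    (a_pos : ∀ k, 0 < a k) (ta : Tendsto a atTop (𝓝 0)) (b : ℕ → ℝ) (L : ℕ → ℕ)
    (tL : Tendsto (fun k => a k * L k) atTop atTop) (k : ℕ) (w : 𝓢(EuclideanSpace ℝ (Fin 4), ℝ)) :
    latticeSchwinger r.ρ (SpeciesScheme.mk a a_pos ta b L tL (fun _ _ => 1) (fun _ _ => 0))
        (fun s => s.F) k (1 + 1) (fun _ => r.curvature) ![w, thetaTest 4 w] -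
      latticeSchwinger r.ρ (SpeciesScheme.mk a a_pos ta b L tL (fun _ _ => 1) (fun _ _ => 0))
        (fun s => s.F) k 1 (fun _ => r.curvature) ![w] *
      latticeSchwinger r.ρ (SpeciesScheme.mk a a_pos ta b L tL (fun _ _ => 1) (fun _ _ => 0))
        (fun s => s.F) k 1 (fun _ => r.curvature) ![thetaTest 4 w] =
    (∫ U, smearedLatticeField r.curvature.F (box 4 (L k)) (a k) 1 0 w (torusLift (2 * L k + 1) U) *
        smearedLatticeField r.curvature.F (box 4 (L k)) (a k) 1 0 (thetaTest 4 w) (torusLift (2 * L k + 1) U)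
      ∂(wilsonMeasure r.ρ (b k) : Measure (GaugeConfig 4 (2 * L k + 1) G))) -
    (∫ U, smearedLatticeField r.curvature.F (box 4 (L k)) (a k) 1 0 w (torusLift (2 * L k + 1) U)
      ∂(wilsonMeasure r.ρ (b k) : Measure (GaugeConfig 4 (2 * L k + 1) G))) *
    (∫ U, smearedLatticeField r.curvature.F (box 4 (L k)) (a k) 1 0 (thetaTest 4 w) (torusLift (2 * L k + 1) U)
      ∂(wilsonMeasure r.ρ (b k) : Measure (GaugeConfig 4 (2 * L k + 1) G))) := by
  simp only [latticeSchwinger, SpeciesScheme.side, Fin.prod_univ_succ, Fin.prod_univ_zero,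
    Matrix.cons_val_zero, Matrix.cons_val_succ, Matrix.cons_val_fin_one, mul_one]
  rfl

/-- **The pointwise one-scale law implies ONE SCALE at the lock with cofinal volumes** (stub
`stub_lawToCofinal` of the line `registered`, reshape 7, of stmt-QuantumFields-15915; the hypothesis is the
registered open stub `stub_oneScaleLaw` verbatim, the conclusion the reshape-6 stub `stub_oneScaleCofinal`
verbatim).  Along a locked critical datum `(β, m̂, S₁, K)`: `φ = id`; the unit is the law's unit at the indices
where `β₀ ≤ β k ∧ m̂ k ≤ m₀` (eventually all, since `β → ∞` and `m̂ → 0`) and `m̂ k / Δ₀` elsewhere, so the pin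
`Δ₀ a_k ≤ m̂ k` holds everywhere; UNIF₁ / SHARP₁ at index `k` are UNIFORM / SHARP read at `k`; the volumes are
taken from the law's cofinal set above `max (L₀ k) (max (S₁ k) ⌈(a k)⁻¹ ^ 2⌉₊)`, which gives `L ≥ L₀`, `L ≥ S₁`
and polynomial growth with `N = 1` (`(a k)⁻¹ = a k · (a k)⁻² ≤ a k · L k`); finally the stub's `T u k` is the
law's explicit covariance by `bare_truncatedTwoPoint_eq` after destructuring the scheme record. [folklore] -/
theorem stub_lawToCofinal :
    (∀ (G : Type) [Group G] [TopologicalSpace G] [IsTopologicalGroup G] [CompactSpace G]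
      [MeasurableSpace G] [BorelSpace G], IsCompactSimpleLieGroup G → ∃ r : LatticeRep G, ∀ K : ℝ, 0 < K →
      ∃ (u : 𝓢(EuclideanSpace ℝ (Fin 4), ℝ)) (p : ℕ) (M Δ₀ β₀ m₀ : ℝ),
        tsupport u ⊆ {y : EuclideanSpace ℝ (Fin 4) | y 0 < 0} ∧ 0 < Δ₀ ∧ 0 < m₀ ∧
        ∀ (β m : ℝ) (T₀ : ℕ), β₀ ≤ β → 0 < m → m ≤ m₀ →
          (∀ A B : YMSpecies G, ∃ C : ℝ, ∀ S n : ℕ, T₀ ≤ S → n ≤ S →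
            |latticeConnectedCorr r.ρ β (2 * S + 1) A.F B.F n| ≤ C * Real.exp (-(m * n))) →
          (∀ S₀ : ℕ, ∃ A B : YMSpecies G, ∀ C : ℝ, ∃ S n : ℕ, S₀ ≤ S ∧ n ≤ S ∧
            C * Real.exp (-(K * m * n)) < |latticeConnectedCorr r.ρ β (2 * S + 1) A.F B.F n|) →
          ∃ a : ℝ, 0 < a ∧ Δ₀ * a ≤ m ∧ ∀ L₁ : ℕ, ∃ L : ℕ, L₁ ≤ L ∧
            ∀ T : 𝓢(EuclideanSpace ℝ (Fin 4), ℝ) → ℝ,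
              (∀ w, T w =
                (∫ U, smearedLatticeField r.curvature.F (box 4 L) a 1 0 w (torusLift (2 * L + 1) U) *
                    smearedLatticeField r.curvature.F (box 4 L) a 1 0 (thetaTest 4 w) (torusLift (2 * L + 1) U)
                  ∂(wilsonMeasure r.ρ β : Measure (GaugeConfig 4 (2 * L + 1) G))) -
                (∫ U, smearedLatticeField r.curvature.F (box 4 L) a 1 0 w (torusLift (2 * L + 1) U)
                  ∂(wilsonMeasure r.ρ β : Measure (GaugeConfig 4 (2 * L + 1) G))) *
                (∫ U, smearedLatticeField r.curvature.F (box 4 L) a 1 0 (thetaTest 4 w) (torusLift (2 * L + 1) U)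
                  ∂(wilsonMeasure r.ρ β : Measure (GaugeConfig 4 (2 * L + 1) G)))) →
              a ^ p ≤ T u ∧ T u ≤ M * T (timeShiftTest 4 (-1) u)) →
    ∀ (G : Type) [Group G] [TopologicalSpace G] [IsTopologicalGroup G] [CompactSpace G]
      [MeasurableSpace G] [BorelSpace G], IsCompactSimpleLieGroup G → ∃ r : LatticeRep G,
      ∀ (β : ℕ → ℝ) (mh : ℕ → ℝ) (S₁ : ℕ → ℕ) (K : ℝ), Tendsto β atTop atTop → (∀ k, 0 < mh k) → 0 < K →
      (∀ A B : YMSpecies G, ∃ C : ℝ, ∀ k S n : ℕ, S₁ k ≤ S → n ≤ S →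
        |latticeConnectedCorr r.ρ (β k) (2 * S + 1) A.F B.F n| ≤ C * Real.exp (-(mh k * n))) →
      (∀ k S₀ : ℕ, ∃ A B : YMSpecies G, ∀ C : ℝ, ∃ S n : ℕ, S₀ ≤ S ∧ n ≤ S ∧
        C * Real.exp (-(K * mh k * n)) < |latticeConnectedCorr r.ρ (β k) (2 * S + 1) A.F B.F n|) →
      Tendsto mh atTop (𝓝 0) →
      ∃ (a : ℕ → ℝ) (φ : ℕ → ℕ) (Δ₀ : ℝ), (∀ k, 0 < a k) ∧ StrictMono φ ∧ 0 < Δ₀ ∧ (∀ k, Δ₀ * a k ≤ mh (φ k)) ∧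
        ∀ L₀ : ℕ → ℕ, ∃ (L : ℕ → ℕ) (u : 𝓢(EuclideanSpace ℝ (Fin 4), ℝ)) (p : ℕ) (M : ℝ),
          (∀ k, L₀ k ≤ L k) ∧ (∀ k, S₁ (φ k) ≤ L k) ∧
          (∃ N : ℕ, 1 ≤ N ∧ ∀ᶠ k in atTop, (a k)⁻¹ ≤ (a k * (L k : ℝ)) ^ N) ∧
          tsupport u ⊆ {y : EuclideanSpace ℝ (Fin 4) | y 0 < 0} ∧
          ∀ sch : SpeciesScheme (YMSpecies G), (∀ k, sch.a k = a k) → (∀ k, sch.β k = β (φ k)) →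
            (∀ k, sch.L k = L k) → ∀ T : 𝓢(EuclideanSpace ℝ (Fin 4), ℝ) → ℕ → ℝ,
            (∀ w k, T w k =
              latticeSchwinger r.ρ (SpeciesScheme.mk sch.a sch.a_pos sch.tendsto_a sch.β sch.L sch.tendsto_L
                (fun _ _ => 1) (fun _ _ => 0)) (fun s => s.F) k (1 + 1) (fun _ => r.curvature) ![w, thetaTest 4 w] -
              latticeSchwinger r.ρ (SpeciesScheme.mk sch.a sch.a_pos sch.tendsto_a sch.β sch.L sch.tendsto_L
                (fun _ _ => 1) (fun _ _ => 0)) (fun s => s.F) k 1 (fun _ => r.curvature) ![w] *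
              latticeSchwinger r.ρ (SpeciesScheme.mk sch.a sch.a_pos sch.tendsto_a sch.β sch.L sch.tendsto_L
                (fun _ _ => 1) (fun _ _ => 0)) (fun s => s.F) k 1 (fun _ => r.curvature) ![thetaTest 4 w]) →
            ∀ᶠ k in atTop, (sch.a k) ^ p ≤ T u k ∧ T u k ≤ M * T (timeShiftTest 4 (-1) u) k := by
  intro hlaw G _ _ _ _ _ _ hG
  obtain ⟨r, hr⟩ := hlaw G hG
  refine ⟨r, ?_⟩
  intro β mh S₁ K hβ hmh hK hUNIF hSHARP hcrit
  obtain ⟨u, p, M, Δ₀, β₀, m₀, hu, hΔ₀, hm₀, hL⟩ := hr K hK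
  -- UNIFORM and SHARP read at one index
  have hU1 : ∀ k, ∀ A B : YMSpecies G, ∃ C : ℝ, ∀ S n : ℕ, S₁ k ≤ S → n ≤ S →
      |latticeConnectedCorr r.ρ (β k) (2 * S + 1) A.F B.F n| ≤ C * Real.exp (-(mh k * n)) := by
    intro k A B
    obtain ⟨C, hC⟩ := hUNIF A B
    exact ⟨C, fun S n hS hn => hC k S n hS hn⟩
  -- the unit: the law's unit where the law applies, `mh k / Δ₀` elsewhere
  have key : ∀ k, ∃ a : ℝ, 0 < a ∧ Δ₀ * a ≤ mh k ∧ ((β₀ ≤ β k ∧ mh k ≤ m₀) → ∀ L₁ : ℕ, ∃ L : ℕ, L₁ ≤ L ∧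
      ∀ T : 𝓢(EuclideanSpace ℝ (Fin 4), ℝ) → ℝ,
        (∀ w, T w =
          (∫ U, smearedLatticeField r.curvature.F (box 4 L) a 1 0 w (torusLift (2 * L + 1) U) *
              smearedLatticeField r.curvature.F (box 4 L) a 1 0 (thetaTest 4 w) (torusLift (2 * L + 1) U)
            ∂(wilsonMeasure r.ρ (β k) : Measure (GaugeConfig 4 (2 * L + 1) G))) -
          (∫ U, smearedLatticeField r.curvature.F (box 4 L) a 1 0 w (torusLift (2 * L + 1) U)
            ∂(wilsonMeasure r.ρ (β k) : Measure (GaugeConfig 4 (2 * L + 1) G))) *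
          (∫ U, smearedLatticeField r.curvature.F (box 4 L) a 1 0 (thetaTest 4 w) (torusLift (2 * L + 1) U)
            ∂(wilsonMeasure r.ρ (β k) : Measure (GaugeConfig 4 (2 * L + 1) G)))) →
        a ^ p ≤ T u ∧ T u ≤ M * T (timeShiftTest 4 (-1) u)) := by
    intro k
    by_cases hk : β₀ ≤ β k ∧ mh k ≤ m₀
    · obtain ⟨a, ha, hpin, hfw⟩ := hL (β k) (mh k) (S₁ k) hk.1 (hmh k) hk.2 (hU1 k) (hSHARP k)
      exact ⟨a, ha, hpin, fun _ => hfw⟩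
    · refine ⟨mh k / Δ₀, div_pos (hmh k) hΔ₀, ?_, fun h => absurd h hk⟩
      rw [mul_div_cancel₀ _ hΔ₀.ne']
  choose a ha hpin hfw using key
  refine ⟨a, id, Δ₀, ha, strictMono_id, hΔ₀, hpin, ?_⟩
  intro L₀
  -- the volumes: from the law's cofinal set, above `L₀`, `S₁` and `⌈a⁻²⌉`
  have key2 : ∀ k, ∃ L : ℕ, max (L₀ k) (max (S₁ k) ⌈(a k)⁻¹ ^ 2⌉₊) ≤ L ∧ ((β₀ ≤ β k ∧ mh k ≤ m₀) →
      ∀ T : 𝓢(EuclideanSpace ℝ (Fin 4), ℝ) → ℝ,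
        (∀ w, T w =
          (∫ U, smearedLatticeField r.curvature.F (box 4 L) (a k) 1 0 w (torusLift (2 * L + 1) U) *
              smearedLatticeField r.curvature.F (box 4 L) (a k) 1 0 (thetaTest 4 w) (torusLift (2 * L + 1) U)
            ∂(wilsonMeasure r.ρ (β k) : Measure (GaugeConfig 4 (2 * L + 1) G))) -
          (∫ U, smearedLatticeField r.curvature.F (box 4 L) (a k) 1 0 w (torusLift (2 * L + 1) U)
            ∂(wilsonMeasure r.ρ (β k) : Measure (GaugeConfig 4 (2 * L + 1) G))) *
          (∫ U, smearedLatticeField r.curvature.F (box 4 L) (a k) 1 0 (thetaTest 4 w) (torusLift (2 * L + 1) U)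
            ∂(wilsonMeasure r.ρ (β k) : Measure (GaugeConfig 4 (2 * L + 1) G)))) →
        a k ^ p ≤ T u ∧ T u ≤ M * T (timeShiftTest 4 (-1) u)) := by
    intro k
    by_cases hk : β₀ ≤ β k ∧ mh k ≤ m₀
    · obtain ⟨L, hL1, hL2⟩ := hfw k hk (max (L₀ k) (max (S₁ k) ⌈(a k)⁻¹ ^ 2⌉₊))
      exact ⟨L, hL1, fun _ => hL2⟩
    · exact ⟨max (L₀ k) (max (S₁ k) ⌈(a k)⁻¹ ^ 2⌉₊), le_rfl, fun h => absurd h hk⟩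
  choose L hLge hLfw using key2
  refine ⟨L, u, p, M, fun k => (le_max_left _ _).trans (hLge k),
    fun k => ((le_max_left _ _).trans (le_max_right _ _)).trans (hLge k), ⟨1, le_rfl, ?_⟩, hu, ?_⟩
  · -- polynomial volume growth with `N = 1`
    refine Eventually.of_forall fun k => ?_
    have h1 : ((⌈(a k)⁻¹ ^ 2⌉₊ : ℕ) : ℝ) ≤ (L k : ℝ) := by
      exact_mod_cast ((le_max_right _ _).trans (le_max_right _ _)).trans (hLge k)
    have h2 : (a k)⁻¹ ^ 2 ≤ ((⌈(a k)⁻¹ ^ 2⌉₊ : ℕ) : ℝ) := Nat.le_ceil _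
    have h3 : (a k)⁻¹ = a k * (a k)⁻¹ ^ 2 := by
      rw [sq, ← mul_assoc, mul_inv_cancel₀ (ha k).ne', one_mul]
    rw [pow_one, h3]
    exact mul_le_mul_of_nonneg_left (h2.trans h1) (ha k).le
  · -- floor ∧ window along every scheme on `(a, β, L)`
    intro sch hsa hsβ hsL T hT
    have hev : ∀ᶠ k in atTop, β₀ ≤ β k ∧ mh k ≤ m₀ :=
      (hβ.eventually_ge_atTop β₀).and ((hcrit.eventually (Iio_mem_nhds hm₀)).mono fun k hk => le_of_lt hk)
    refine hev.mono fun k hk => ?_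
    obtain ⟨sa, sa_pos, sta, sb, sL, stL, sc, sm⟩ := sch
    obtain rfl : a = sa := (funext hsa).symm
    obtain rfl : L = sL := (funext hsL).symm
    obtain rfl : (fun k => β (id k)) = sb := (funext hsβ).symm
    refine hLfw k hk (fun w => T w k) fun w => ?_
    rw [hT w k]
    exact bare_truncatedTwoPoint_eq r a sa_pos sta (fun k => β (id k)) L stL k w

end Summit.QuantumFields.YangMills.Theorems.ContinuumFromLatticeGap

end
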